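import Mathlib
import HarnessLib

/-!
# Stub `stub_coxeterOrderArith` (line `Sketch`, crux `SerreGSp4Surjective`, stmt-Langlands-17765)

Elementary arithmetic of the order `(p² + 1) / 2` of the Coxeter torus of `Sp₄(𝔽_p)` modulo its
centre, for an odd prime `p`:

* `(p² + 1) / 2` is odd (since `p = 2k + 1` gives `p² + 1 = 2 · (2(k² + k) + 1)`);
* every odd prime `q ∣ p² + 1` satisfies `q ≡ 1 (mod 4)`: in `ZMod q` one has `p² = -1`, so `-1`
  is a square mod `q`, and the first supplement to quadratic reciprocity
  (`ZMod.exists_sq_eq_neg_one_iff`) gives `q % 4 ≠ 3`; as `q` is odd, `q % 4 = 1`.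

Consequently every prime `P` dividing a divisor `d` of `(p² + 1) / 2` is `≥ 5`, which is what the
type-evaporation step of the line needs (no passage through characteristic `2` or `3`).
-/

set_option linter.dupNamespace false -- `Summit.Langlands.Langlands` is the mandated namespace

namespace Summit.Langlands.Langlands.Cruxes.SerreGSp4Surjective.Sketch

/-- For an odd natural number `p`, the half `(p² + 1) / 2` is odd. -/
private theorem odd_sq_add_one_div_two {p : ℕ} (hp : Odd p) : Odd ((p ^ 2 + 1) / 2) := by
  obtain ⟨k, rfl⟩ := hp
  refine ⟨k ^ 2 + k, ?_⟩
  have h : (2 * k + 1) ^ 2 + 1 = (2 * (k ^ 2 + k) + 1) * 2 := by ring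
  rw [h, Nat.mul_div_cancel _ two_pos]

/-- An odd prime `q` dividing `p² + 1` is congruent to `1` modulo `4`. -/
private theorem mod_four_eq_one_of_prime_dvd_sq_add_one {p q : ℕ} (hq : q.Prime)
    (hdvd : q ∣ p ^ 2 + 1) (hq2 : q ≠ 2) : q % 4 = 1 := by
  haveI : Fact q.Prime := ⟨hq⟩
  have hcast : ((p : ZMod q)) ^ 2 + 1 = 0 := by
    have h0 : ((p ^ 2 + 1 : ℕ) : ZMod q) = 0 := (ZMod.natCast_eq_zero_iff _ _).2 hdvd
    push_cast at h0
    exact h0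
  have hsq : (p : ZMod q) ^ 2 = -1 := eq_neg_of_add_eq_zero_left hcast
  have hne3 : q % 4 ≠ 3 := ZMod.mod_four_ne_three_of_sq_eq_neg_one hsq
  have hodd : q % 2 = 1 := hq.mod_two_eq_one_iff_ne_two.2 hq2
  omega

/-- **Coxeter-order arithmetic.** For an odd prime `p`, `(p² + 1) / 2` is odd, and every odd prime
divisor `q` of `p² + 1` satisfies `q ≡ 1 (mod 4)`. -/
theorem stub_coxeterOrderArith :
    ∀ p : ℕ, p.Prime → p ≠ 2 →
      Odd ((p ^ 2 + 1) / 2) ∧ ∀ q : ℕ, q.Prime → q ∣ p ^ 2 + 1 → q ≠ 2 → q % 4 = 1 :=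
  fun _ hp hp2 =>
    ⟨odd_sq_add_one_div_two (hp.odd_of_ne_two hp2),
      fun _ hq hdvd hq2 => mod_four_eq_one_of_prime_dvd_sq_add_one hq hdvd hq2⟩

end Summit.Langlands.Langlands.Cruxes.SerreGSp4Surjective.Sketch
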